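import Summits.HubbardSuperconductivity.HubbardSuperconductivity.Theorems.AnisotropyChordTransferFibre3FamilyALemmas
import Literature.AlgebraicTopology.CellComplexes.CubicalTorusHomology

/-!
# Route `AnisotropyChord` / H0 rotor rung: PartN38 — the lattice identity `SumCscSq` PROVED: `Σ_{n=1}^{L−1} 1/sin²(πn/L) = (L²−1)/3`

Typed target `SumCscSq` of `…Fibre3FamilyALemmas` (PORT PartN38, theory seat `hubbard-h0-rotor-theory-1` g21, memo 21 §316;
one of the two lattice identities behind the certified family-A enclosures).
Proof by PARSEVAL ON `ℤ/L`: the function `h(r) = val r` has discrete derivative `h(r) − h(r−1) = 1 − L·δ₀(r)`, whose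
Fourier transform is `−L` off the zero mode; hence `|ĥ(k)|²·|1 − e^{2πik/L}|² = L²` for `k ≠ 0`, while
`Σ_k |ĥ(k)|² = L·Σ_{r<L} r²` and `ĥ(0) = Σ_{r<L} r`.  With `|1 − e^{iθ}|² = 4 sin²(θ/2)` this is the identity.
Ingredients: the tree's additive character `phZ` (`phZ_add`, `conj_phZ`, `sum_phZ_mul`, `…Fibre3Fourier`), the `ZMod`
bookkeeping `val_add_one_of_ne/eq`, `sum_univ_zmod` of `Literature.AlgebraicTopology.CellComplexes.CubicalTorus`.
Prover seat `hubbard-h0-rotor-p1` g23; helper for stmt-HubbardSuperconductivity-19089 (`--supports`).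
-/

set_option linter.dupNamespace false
set_option autoImplicit false

noncomputable section

open scoped BigOperators
open Complex

namespace Summit.HubbardSuperconductivity.HubbardSuperconductivity.Theorems.AnisotropyChord.Transfer.Fibre3

variable (L : ℕ) [NeZero L]

/-! ## Parseval on `ℤ/L` -/

/-- one-dimensional discrete Fourier transform on `ZMod L`. [folklore] -/
def dft1 (h : ZMod L → ℂ) (k : ZMod L) : ℂ := ∑ r : ZMod L, (starRingEnd ℂ) (phZ L (k * r)) * h r

/-- **Parseval on `ℤ/L`:** `Σ_k |ĥ(k)|² = L·Σ_r |h(r)|²`. [folklore] -/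
theorem parseval_zmod (h : ZMod L → ℂ) :
    ∑ k : ZMod L, Complex.normSq (dft1 L h k) = (L : ℝ) * ∑ r : ZMod L, Complex.normSq (h r) := by
  apply Complex.ofReal_injective
  push_cast
  have hX : ∀ k : ZMod L, ((Complex.normSq (dft1 L h k) : ℝ) : ℂ)
      = ∑ r : ZMod L, ∑ r' : ZMod L, (starRingEnd ℂ) (h r) * h r' * phZ L (k * (r - r')) := by
    intro k
    rw [Complex.normSq_eq_conj_mul_self]
    unfold dft1
    rw [map_sum, Finset.sum_mul_sum]
    refine Finset.sum_congr rfl fun r _ => Finset.sum_congr rfl fun r' _ => ?_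
    rw [map_mul, Complex.conj_conj, conj_phZ, show k * (r - r') = k * r + -(k * r') by ring, phZ_add]
    ring
  rw [Finset.sum_congr rfl fun k _ => hX k, Finset.sum_comm, Finset.mul_sum]
  refine Finset.sum_congr rfl fun r _ => ?_
  rw [Finset.sum_comm]
  have hq : ∀ r' : ZMod L, ∑ k : ZMod L, (starRingEnd ℂ) (h r) * h r' * phZ L (k * (r - r'))
      = if r - r' = 0 then (starRingEnd ℂ) (h r) * h r' * (L : ℂ) else 0 := by
    intro r'
    rw [← Finset.mul_sum, sum_phZ_mul]
    split_ifs <;> simp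
  rw [Finset.sum_congr rfl fun r' _ => hq r']
  simp only [sub_eq_zero]
  rw [Finset.sum_ite_eq]
  simp only [Finset.mem_univ, if_true]
  rw [Complex.normSq_eq_conj_mul_self]
  ring

/-- the transform of a backward shift: `FT[h(·−1)](k) = conj φ(k)·ĥ(k)`. [folklore] -/
theorem dft1_shift (h : ZMod L → ℂ) (k : ZMod L) :
    dft1 L (fun r => h (r - 1)) k = (starRingEnd ℂ) (phZ L k) * dft1 L h k := by
  unfold dft1
  rw [Finset.mul_sum, ← Equiv.sum_comp (Equiv.addRight (1 : ZMod L))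
    (fun r => (starRingEnd ℂ) (phZ L (k * r)) * h (r - 1))]
  refine Finset.sum_congr rfl fun s _ => ?_
  simp only [Equiv.coe_addRight, add_sub_cancel_right]
  rw [mul_add, mul_one, phZ_add, map_mul]
  ring

/-- the transform of the discrete derivative: `FT[h − h(·−1)](k) = (1 − conj φ(k))·ĥ(k)`. [folklore] -/
theorem dft1_bwdDiff (h : ZMod L → ℂ) (k : ZMod L) :
    dft1 L (fun r => h r - h (r - 1)) k = (1 - (starRingEnd ℂ) (phZ L k)) * dft1 L h k := by
  have e : dft1 L (fun r => h r - h (r - 1)) k = dft1 L h k - dft1 L (fun r => h (r - 1)) k := by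
    unfold dft1; rw [← Finset.sum_sub_distrib]; refine Finset.sum_congr rfl fun r _ => ?_; ring
  rw [e, dft1_shift]; ring

/-! ## The function `h(r) = val r` -/

/-- the discrete derivative of `val` on `ℤ/L`: `val r − val(r−1) = 1 − L·[r = 0]`. [folklore] -/
theorem val_sub_val_pred (r : ZMod L) :
    (((r.val : ℕ) : ℂ) - (((r - 1).val : ℕ) : ℂ)) = if r = 0 then (1 : ℂ) - (L : ℂ) else 1 := by
  by_cases hr : r = 0
  · rw [if_pos hr, hr, ZMod.val_zero, zero_sub]
    have h := Literature.AlgebraicTopology.CellComplexes.CubicalTorus.val_add_one_of_eq (N := L) (a := -1) rfl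
    have h' : (((-1 : ZMod L).val : ℕ) : ℂ) + 1 = (L : ℂ) := by exact_mod_cast h
    push_cast
    linear_combination (-1 : ℂ) * h'
  · rw [if_neg hr]
    have hne : r - 1 ≠ -1 := by
      intro h; apply hr
      calc r = (r - 1) + 1 := (sub_add_cancel r 1).symm
        _ = -1 + 1 := by rw [h]
        _ = 0 := neg_add_cancel 1
    have h := Literature.AlgebraicTopology.CellComplexes.CubicalTorus.val_add_one_of_ne (N := L) hne
    rw [sub_add_cancel] at h
    rw [h]; push_cast; ring

/-- the transform of `1 − L·δ₀` vanishes nowhere off the zero mode: it equals `−L` there. [folklore] -/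
theorem dft1_one_sub_delta {k : ZMod L} (hk : k ≠ 0) :
    dft1 L (fun r => if r = 0 then (1 : ℂ) - (L : ℂ) else 1) k = -(L : ℂ) := by
  unfold dft1
  have e : ∀ r : ZMod L, (starRingEnd ℂ) (phZ L (k * r)) * (if r = 0 then (1 : ℂ) - (L : ℂ) else 1)
      = (starRingEnd ℂ) (phZ L (k * r)) - (if r = 0 then (L : ℂ) else 0) := by
    intro r
    split_ifs with h
    · rw [h, mul_zero, phZ_zero, map_one]; ring
    · ring
  rw [Finset.sum_congr rfl fun r _ => e r, Finset.sum_sub_distrib, Finset.sum_ite_eq' Finset.univ (0 : ZMod L)]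
  simp only [Finset.mem_univ, if_true]
  rw [← map_sum]
  have hs : ∑ r : ZMod L, phZ L (k * r) = 0 := by
    have := sum_phZ_mul L k
    rw [if_neg hk] at this
    rw [← this]
    exact Finset.sum_congr rfl fun r _ => by rw [mul_comm]
  rw [hs, map_zero, zero_sub]

omit [NeZero L] in
/-- `|1 − e^{2πi·val k/L}|² = 4 sin²(π·val k/L)`. [folklore] -/
theorem normSq_one_sub_phZ (k : ZMod L) :
    Complex.normSq (1 - phZ L k) = 4 * Real.sin (Real.pi * k.val / L) ^ 2 := by
  unfold phZ
  set θ : ℝ := 2 * Real.pi * k.val / L with hθ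
  have e : (2 * (Real.pi : ℂ) * Complex.I * (((k.val : ℕ) : ℂ) / (L : ℂ))) = (θ : ℂ) * Complex.I := by
    rw [hθ]; push_cast; ring
  rw [e, Complex.exp_mul_I, Complex.normSq_apply]
  simp only [Complex.sub_re, Complex.one_re, Complex.add_re, Complex.mul_re, Complex.I_re, Complex.I_im,
    Complex.sub_im, Complex.one_im, Complex.add_im, Complex.mul_im,
    Complex.cos_ofReal_re, Complex.sin_ofReal_re, Complex.cos_ofReal_im, Complex.sin_ofReal_im]
  have h1 := Real.sin_sq_add_cos_sq θ
  have h2 : Real.cos θ = 1 - 2 * Real.sin (Real.pi * k.val / L) ^ 2 := by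
    rw [show θ = 2 * (Real.pi * k.val / L) by rw [hθ]; ring, Real.cos_two_mul, Real.cos_sq']
    ring
  nlinarith [h1, h2]

/-- the key Fourier fact: `|FT[val](k)|² · 4 sin²(π val k/L) = L²` for `k ≠ 0`. [folklore] -/
theorem normSq_dft1_val {k : ZMod L} (hk : k ≠ 0) :
    Complex.normSq (dft1 L (fun r => ((r.val : ℕ) : ℂ)) k) * (4 * Real.sin (Real.pi * k.val / L) ^ 2) = (L : ℝ) ^ 2 := by
  have hd : dft1 L (fun r => ((r.val : ℕ) : ℂ) - (((r - 1).val : ℕ) : ℂ)) k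
      = dft1 L (fun r => if r = 0 then (1 : ℂ) - (L : ℂ) else 1) k := by
    simp only [dft1, val_sub_val_pred]
  have h1 := dft1_bwdDiff L (fun r => ((r.val : ℕ) : ℂ)) k
  rw [hd, dft1_one_sub_delta L hk] at h1
  -- take `normSq`
  have h2 := congrArg Complex.normSq h1
  rw [Complex.normSq_neg, Complex.normSq_natCast, map_mul, ← Complex.normSq_conj (1 - (starRingEnd ℂ) (phZ L k)), map_sub,
    map_one, Complex.conj_conj, normSq_one_sub_phZ] at h2
  linarith

/-! ## Power sums -/

omit [NeZero L] in
/-- `6·Σ_{i<n} i² = (n−1)n(2n−1)`. [folklore] -/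
theorem sum_range_sq (n : ℕ) : ∑ i ∈ Finset.range n, ((i : ℝ)) ^ 2 = ((n : ℝ) - 1) * n * (2 * n - 1) / 6 := by
  induction n with
  | zero => simp
  | succ n ih => rw [Finset.sum_range_succ, ih]; push_cast; ring

omit [NeZero L] in
/-- `2·Σ_{i<n} i = n(n−1)`. [folklore] -/
theorem sum_range_id_real (n : ℕ) : ∑ i ∈ Finset.range n, ((i : ℝ)) = (n : ℝ) * ((n : ℝ) - 1) / 2 := by
  induction n with
  | zero => simp
  | succ n ih => rw [Finset.sum_range_succ, ih]; push_cast; ring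

/-! ## `SumCscSq` -/

/-- the identity over `ZMod L ∖ {0}`: `Σ_{k ≠ 0} 1/sin²(π val k/L) = (L² − 1)/3`. [folklore] -/
theorem sum_inv_sin_sq_zmod :
    ∑ k : ZMod L, (if k = 0 then (0 : ℝ) else 1 / Real.sin (Real.pi * k.val / L) ^ 2) = ((L : ℝ) ^ 2 - 1) / 3 := by
  classical
  have hL : (0 : ℝ) < L := by exact_mod_cast Nat.pos_of_ne_zero (NeZero.ne L)
  set H : ZMod L → ℂ := fun r => ((r.val : ℕ) : ℂ) with hH
  -- Parseval for `val`
  have hP := parseval_zmod L H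
  have hR : ∑ r : ZMod L, Complex.normSq (H r) = ∑ i ∈ Finset.range L, ((i : ℝ)) ^ 2 := by
    rw [Literature.AlgebraicTopology.CellComplexes.CubicalTorus.sum_univ_zmod (N := L)
      (fun r : ZMod L => Complex.normSq (H r))]
    refine Finset.sum_congr rfl fun b hb => ?_
    simp only [hH]
    rw [ZMod.val_natCast_of_lt (Finset.mem_range.1 hb), Complex.normSq_natCast]
    ring
  -- the zero mode
  have h0 : Complex.normSq (dft1 L H 0) = (∑ i ∈ Finset.range L, ((i : ℝ))) ^ 2 := by
    have : dft1 L H 0 = (((∑ i ∈ Finset.range L, ((i : ℝ))) : ℝ) : ℂ) := by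
      unfold dft1
      simp only [zero_mul, phZ_zero, map_one, one_mul, hH]
      rw [Literature.AlgebraicTopology.CellComplexes.CubicalTorus.sum_univ_zmod (N := L)
        (fun r : ZMod L => ((r.val : ℕ) : ℂ))]
      push_cast
      refine Finset.sum_congr rfl fun b hb => ?_
      rw [ZMod.val_natCast_of_lt (Finset.mem_range.1 hb)]
    rw [this, Complex.normSq_ofReal]; ring
  -- nonzero modes: normSq = L² / (4 sin²)
  have hsin : ∀ k : ZMod L, k ≠ 0 → 0 < Real.sin (Real.pi * k.val / L) := by
    intro k hk
    have hv0 : 0 < (k.val : ℝ) := by exact_mod_cast Nat.pos_of_ne_zero ((ZMod.val_ne_zero k).mpr hk)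
    have hvL : (k.val : ℝ) < L := by exact_mod_cast ZMod.val_lt k
    apply Real.sin_pos_of_pos_of_lt_pi
    · positivity
    · rw [div_lt_iff₀ hL]; nlinarith [Real.pi_pos]
  have hk : ∀ k : ZMod L, (if k = 0 then (0 : ℝ) else 1 / Real.sin (Real.pi * k.val / L) ^ 2)
      = (4 / (L : ℝ) ^ 2) * (Complex.normSq (dft1 L H k) - (if k = 0 then Complex.normSq (dft1 L H 0) else 0)) := by
    intro k
    by_cases hk0 : k = 0
    · rw [if_pos hk0, if_pos hk0, hk0, sub_self, mul_zero]
    · rw [if_neg hk0, if_neg hk0, sub_zero]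
      have e := normSq_dft1_val L hk0
      have hs := hsin k hk0
      field_simp
      linarith [e]
  rw [Finset.sum_congr rfl fun k _ => hk k, ← Finset.mul_sum, Finset.sum_sub_distrib, Finset.sum_ite_eq' Finset.univ (0 : ZMod L)]
  simp only [Finset.mem_univ, if_true]
  rw [hP, hR, h0, sum_range_sq, sum_range_id_real]
  field_simp
  ring

/-- ★ **`SumCscSq` holds:** `Σ_{n=1}^{L−1} 1/sin²(πn/L) = (L² − 1)/3` for every `L ≥ 1`. [folklore] -/
theorem sumCscSq_holds : SumCscSq := by
  intro L hL
  haveI : NeZero L := ⟨by omega⟩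
  classical
  rw [← sum_inv_sin_sq_zmod L,
    Literature.AlgebraicTopology.CellComplexes.CubicalTorus.sum_univ_zmod (N := L)
      (fun k : ZMod L => if k = 0 then (0 : ℝ) else 1 / Real.sin (Real.pi * k.val / L) ^ 2)]
  obtain ⟨m, rfl⟩ : ∃ m, L = m + 1 := ⟨L - 1, by omega⟩
  rw [Finset.sum_range_succ', Finset.sum_Ico_eq_sum_range]
  simp only [Nat.cast_zero, if_true, add_zero, show m + 1 - 1 = m from rfl]
  refine Finset.sum_congr rfl fun i hi => ?_
  have hi' : i + 1 < m + 1 := by have := Finset.mem_range.1 hi; omega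
  have hne : ((((i + 1 : ℕ)) : ZMod (m + 1))) ≠ 0 := by
    intro h
    rw [ZMod.natCast_eq_zero_iff] at h
    exact absurd (Nat.le_of_dvd (by omega) h) (by omega)
  rw [if_neg hne, ZMod.val_natCast_of_lt hi']
  push_cast
  ring_nf

end Summit.HubbardSuperconductivity.HubbardSuperconductivity.Theorems.AnisotropyChord.Transfer.Fibre3

end
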